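import Literature.NumberTheory.Transcendental.KZCalculusProofs
import Literature.ModelTheory.ExponentialFields.OMinimalEulerFibres
import Literature.ModelTheory.ExponentialFields.RealExpFieldProofs
import Literature.ModelTheory.ExponentialFields.RealClosedFieldTheoryProofs

/-!
# The o-minimal Euler characteristic of KZ domains: bands, boxes, the open unit ball, the Γ-pair domains

Support for the negative side of crux `CompleteModGammaSector` (§§6A–6B of
`Cruxes/CompleteModGammaSector/Disproof.lean`, cdisprove gen 1). `realEuler n S := eulerChar
orderedRing n S` over the o-minimal field `ℝ` (`real_isOMinimal_holds`); glue as in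
`Cruxes/GpcLegendreLemniscatic/Disproof.lean` §8 (re-proved): `realEuler_box`, `realEuler_Icc`,
`realEuler_band` (a Newton–Leibniz band has the Euler characteristic of its base — fibre formula).
New: `realEuler_ball` — `E(open unit ball of ℝᵈ) = (−1)^d` (fibre formula: over the ball of `ℝᵈ`
the fibres of the ball of `ℝ^{d+1}` are open intervals); `realEuler_cube`, `realEuler_ballCube`
(`eulerChar_prod`) — both Γ-pair domains have ODD Euler characteristic.
-/

noncomputable section

open MeasureTheory Set
open scoped BigOperators Topology

namespace Summit.KontsevichZagierPeriods.CompleteModGammaSectorNegative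

open Literature.NumberTheory.Transcendental
open Literature.NumberTheory.Transcendental.KZ
open Literature.ModelTheory.ExponentialFields (IsSemialgebraic)
open FirstOrder FirstOrder.Language
open Literature.ModelTheory.ExponentialFields
open Literature.ModelTheory.ExponentialFields.CellDimension
open MvPolynomial (aeval X C)

/-! ### §6A Glue: the o-minimal Euler characteristic of semialgebraic subsets of `ℝⁿ`
(as in `Cruxes/GpcLegendreLemniscatic/Disproof.lean` §8 — `realEuler`, `realEuler_Icc`, the band lemma — re-proved here) -/

/-- The o-minimal Euler characteristic of `S ⊆ ℝⁿ` in the ordered field `ℝ` (tree `eulerChar`).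
[cite: Dries1998, Ch. 4 (2.3)] -/
def realEuler (n : ℕ) (S : Set (Fin n → ℝ)) : ℤ := eulerChar Language.orderedRing n S

/-- `ℝ` is o-minimal (tree theorem `real_isOMinimal_holds`). [cite: Dries1998, Ch. 2 (2.11)] -/
theorem isOMinimal_real : Language.orderedRing.IsOMinimal ℝ := real_isOMinimal_holds

/-- `ℚ`-semialgebraic sets are definable in the ordered field `ℝ`. [cite: BasuPollackRoy2006, §2.5.1] -/
theorem definable_univ_of_isSemialgebraic {n : ℕ} {s : Set (Fin n → ℝ)} (hs : IsSemialgebraic ℚ s) :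
    (univ : Set ℝ).Definable Language.orderedRing s :=
  (definable_of_isSemialgebraic hs).mono (subset_univ _)

/-- `<` is definable. [folklore] -/
theorem definable_lt_real : (univ : Set ℝ).Definable Language.orderedRing {v : Fin 2 → ℝ | v 0 < v 1} := by
  have h := Literature.ModelTheory.ExponentialFields.isSemialgebraic_setOf_eval_pos (k := ℚ) (R := ℝ)
    (X 1 - X 0 : MvPolynomial (Fin 2) ℚ)
  have heq : {x : Fin 2 → ℝ | 0 < aeval x (X 1 - X 0 : MvPolynomial (Fin 2) ℚ)} = {v | v 0 < v 1} := by
    ext v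
    simp [sub_pos]
  rw [heq] at h
  exact definable_univ_of_isSemialgebraic h

/-- **`E` of an open box of `ℝᵐ` is `(−1)^m`** (boxes are `(1,…,1)`-cells). [cite: Dries1998, Ch. 4 (2.1)] -/
theorem realEuler_box {m : ℕ} (a b : Fin m → ℝ) (hab : ∀ i, a i < b i) :
    realEuler m {v | ∀ i, a i < v i ∧ v i < b i} = (-1) ^ m := by
  have hcell := isCell_box (L := Language.orderedRing) (M := ℝ) definable_lt_real a b hab
  rw [realEuler, eulerChar_cell isOMinimal_real definable_lt_real hcell,
    dim_eq_typeDim isOMinimal_real definable_lt_real hcell, typeDim_const_true]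

/-- An open box is definable. [folklore] -/
theorem definable_box {m : ℕ} (a b : Fin m → ℝ) (hab : ∀ i, a i < b i) :
    (univ : Set ℝ).Definable Language.orderedRing {v : Fin m → ℝ | ∀ i, a i < v i ∧ v i < b i} :=
  (isCell_box (L := Language.orderedRing) (M := ℝ) definable_lt_real a b hab).definable definable_lt_real

/-- `E` of an open interval of `ℝ¹` is `−1`. [cite: Dries1998, Ch. 4 (2.1)] -/
theorem realEuler_Ioo {a b : ℝ} (hab : a < b) :
    realEuler 1 {y : Fin 1 → ℝ | a < y 0 ∧ y 0 < b} = -1 := by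
  have h := realEuler_box (fun _ : Fin 1 => a) (fun _ => b) (fun _ => hab)
  have hset : {v : Fin 1 → ℝ | ∀ i, (fun _ : Fin 1 => a) i < v i ∧ v i < (fun _ : Fin 1 => b) i} =
      {y : Fin 1 → ℝ | a < y 0 ∧ y 0 < b} := by
    ext v
    simp [Fin.forall_fin_one]
  rw [hset] at h
  rw [h]
  norm_num

/-- `E` of a point of `ℝ¹` is `1`. [cite: Dries1998, Ch. 4 (2.1)] -/
theorem realEuler_point (c : ℝ) : realEuler 1 {y : Fin 1 → ℝ | y 0 = c} = 1 := by
  have hset : {y : Fin 1 → ℝ | y 0 = c} = {fun _ => c} := by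
    ext y
    simp only [mem_setOf_eq, mem_singleton_iff]
    constructor
    · intro h
      funext i
      rw [Fin.fin_one_eq_zero i]
      exact h
    · intro h
      rw [h]
  rw [realEuler, hset, eulerChar_eq_ncard_of_finite isOMinimal_real definable_lt_real (Set.finite_singleton _),
    Set.ncard_singleton]
  rfl

/-- **`E([a,b]) = 1`** for a closed bounded interval of `ℝ¹` (`a ≤ b`). [cite: Dries1998, Ch. 4 (2.9)] -/
theorem realEuler_Icc {a b : ℝ} (hab : a ≤ b) :
    realEuler 1 {y : Fin 1 → ℝ | a ≤ y 0 ∧ y 0 ≤ b} = 1 := by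
  rcases hab.eq_or_lt with rfl | hlt'
  · have hset : {y : Fin 1 → ℝ | a ≤ y 0 ∧ y 0 ≤ a} = {y | y 0 = a} := by
      ext y
      simp only [mem_setOf_eq]
      constructor
      · intro h; exact le_antisymm h.2 h.1
      · intro h; exact ⟨h.ge, h.le⟩
    rw [hset]
    exact realEuler_point a
  · set P₁ : Set (Fin 1 → ℝ) := {y | y 0 = a} with hP₁
    set I : Set (Fin 1 → ℝ) := {y | a < y 0 ∧ y 0 < b} with hI
    set P₂ : Set (Fin 1 → ℝ) := {y | y 0 = b} with hP₂
    have hset : {y : Fin 1 → ℝ | a ≤ y 0 ∧ y 0 ≤ b} = (P₁ ∪ I) ∪ P₂ := by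
      ext y
      simp only [mem_setOf_eq, mem_union, hP₁, hI, hP₂]
      constructor
      · intro h
        rcases h.1.eq_or_lt with h1 | h1
        · exact Or.inl (Or.inl h1.symm)
        · rcases h.2.eq_or_lt with h2 | h2
          · exact Or.inr h2
          · exact Or.inl (Or.inr ⟨h1, h2⟩)
      · rintro ((h | h) | h)
        · exact ⟨h.symm.le, h ▸ hlt'.le⟩
        · exact ⟨h.1.le, h.2.le⟩
        · exact ⟨h ▸ hlt'.le, h.le⟩
    have hfin : ∀ c : ℝ, ({y : Fin 1 → ℝ | y 0 = c} : Set (Fin 1 → ℝ)).Finite := by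
      intro c
      have : ({y : Fin 1 → ℝ | y 0 = c} : Set (Fin 1 → ℝ)) = {fun _ => c} := by
        ext y; simp only [mem_setOf_eq, mem_singleton_iff]
        constructor
        · intro h; funext i; rw [Fin.fin_one_eq_zero i]; exact h
        · intro h; rw [h]
      rw [this]; exact Set.finite_singleton _
    have hP₁def : (univ : Set ℝ).Definable Language.orderedRing P₁ := definable_of_finite (hfin a)
    have hP₂def : (univ : Set ℝ).Definable Language.orderedRing P₂ := definable_of_finite (hfin b)
    have hIdef : (univ : Set ℝ).Definable Language.orderedRing I := by
      have h := definable_box (fun _ : Fin 1 => a) (fun _ => b) (fun _ => hlt')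
      have hIset : {v : Fin 1 → ℝ | ∀ i, (fun _ : Fin 1 => a) i < v i ∧ v i < (fun _ : Fin 1 => b) i} = I := by
        ext v
        simp [hI, Fin.forall_fin_one]
      rwa [hIset] at h
    have hd1 : Disjoint P₁ I := Set.disjoint_left.mpr fun y hy hyI => by
      simp only [hP₁, mem_setOf_eq] at hy
      simp only [hI, mem_setOf_eq] at hyI
      linarith [hyI.1]
    have hd2 : Disjoint (P₁ ∪ I) P₂ := Set.disjoint_left.mpr fun y hy hyP => by
      simp only [hP₂, mem_setOf_eq] at hyP
      rcases hy with hy | hy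
      · simp only [hP₁, mem_setOf_eq] at hy; linarith
      · simp only [hI, mem_setOf_eq] at hy; linarith [hy.2]
    rw [hset, realEuler, eulerChar_union isOMinimal_real definable_lt_real (hP₁def.union hIdef) hP₂def hd2,
      eulerChar_union isOMinimal_real definable_lt_real hP₁def hIdef hd1]
    have e1 := realEuler_point a
    have e2 := realEuler_Ioo hlt'
    have e3 := realEuler_point b
    simp only [realEuler] at e1 e2 e3
    rw [e1, e2, e3]
    norm_num

/-- `Fin.init (Fin.append x y) = x` for `y : Fin 1 → ℝ`. [folklore] -/
theorem init_append_one {n : ℕ} (x : Fin n → ℝ) (y : Fin 1 → ℝ) :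
    Fin.init (Fin.append x y : Fin (n + 1) → ℝ) = x := by
  funext i
  exact Fin.append_left x y i

/-- `(Fin.append x y) (Fin.last n) = y 0` for `y : Fin 1 → ℝ`. [folklore] -/
theorem append_last_one {n : ℕ} (x : Fin n → ℝ) (y : Fin 1 → ℝ) :
    (Fin.append x y : Fin (n + 1) → ℝ) (Fin.last n) = y 0 := by
  rw [show Fin.last n = Fin.natAdd n (0 : Fin 1) from Fin.ext (by simp)]
  exact Fin.append_right x y 0

/-- **A Newton–Leibniz band has the Euler characteristic of its base** (fibre formula with closed
bounded fibres `[a x, b x]`, `E = 1`). [cite: Dries1998, Ch. 4 (2.11)] -/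
theorem realEuler_band {n : ℕ} (r : IntegralRep (n + 1)) (r' : IntegralRep n)
    {a b : (Fin n → ℝ) → ℝ} (hab : ∀ x ∈ r'.domain, a x ≤ b x)
    (hdom : r.domain = {z | (Fin.init z : Fin n → ℝ) ∈ r'.domain ∧ a (Fin.init z) ≤ z (Fin.last n) ∧
      z (Fin.last n) ≤ b (Fin.init z)}) :
    realEuler (n + 1) r.domain = realEuler n r'.domain := by
  rw [realEuler, realEuler]
  have hS : (univ : Set ℝ).Definable Language.orderedRing r.domain :=
    definable_univ_of_isSemialgebraic r.isSemialgebraic_domain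
  have hfib : ∀ x : Fin n → ℝ, {y : Fin 1 → ℝ | Fin.append x y ∈ r.domain} =
      {y | x ∈ r'.domain ∧ a x ≤ y 0 ∧ y 0 ≤ b x} := by
    intro x
    ext y
    rw [mem_setOf_eq, hdom, mem_setOf_eq, init_append_one, append_last_one]
    rfl
  have hproj : {x : Fin n → ℝ | ∃ y : Fin 1 → ℝ, Fin.append x y ∈ r.domain} = r'.domain := by
    ext x
    simp only [mem_setOf_eq]
    constructor
    · rintro ⟨y, hy⟩
      have h : y ∈ {y : Fin 1 → ℝ | Fin.append x y ∈ r.domain} := hy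
      rw [hfib x] at h
      exact h.1
    · intro hx
      refine ⟨fun _ => a x, ?_⟩
      have h : (fun _ : Fin 1 => a x) ∈ {y : Fin 1 → ℝ | Fin.append x y ∈ r.domain} := by
        rw [hfib x]
        exact ⟨hx, le_rfl, hab x hx⟩
      exact h
  rw [eulerChar_eq_eulerChar_proj_mul isOMinimal_real definable_lt_real hS (e := 1) fun x ⟨y, hy⟩ => ?_,
    hproj, mul_one]
  have hx : x ∈ r'.domain := by
    have h : y ∈ {y : Fin 1 → ℝ | Fin.append x y ∈ r.domain} := hy
    rw [hfib x] at h
    exact h.1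
  rw [hfib x]
  have hset : {y : Fin 1 → ℝ | x ∈ r'.domain ∧ a x ≤ y 0 ∧ y 0 ≤ b x} = {y | a x ≤ y 0 ∧ y 0 ≤ b x} := by
    ext y
    simp only [mem_setOf_eq]
    exact ⟨fun h => h.2, fun h => ⟨hx, h⟩⟩
  rw [hset]
  exact realEuler_Icc (hab x hx)

/-! ### §6B `E` of the open unit ball and of the Γ-pair domains (new) -/

/-- The open unit ball of `ℝᵈ`. -/
def ball (d : ℕ) : Set (Fin d → ℝ) := {x | ∑ i, x i ^ 2 < 1}

/-- The open unit ball is `ℚ`-semialgebraic. [folklore] -/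
theorem isSemialgebraic_ball (d : ℕ) : IsSemialgebraic ℚ (ball d) := by
  have h := Literature.ModelTheory.ExponentialFields.isSemialgebraic_setOf_eval_pos (k := ℚ) (R := ℝ)
    (1 - ∑ i : Fin d, X i ^ 2 : MvPolynomial (Fin d) ℚ)
  convert h using 1
  ext x
  simp [ball, sub_pos]

/-- **`E(open unit ball of ℝᵈ) = (−1)^d`** (fibre formula: over the ball of `ℝᵈ` the fibres of
the ball of `ℝ^{d+1}` are open intervals). [cite: Dries1998, Ch. 4 (2.11)] -/
theorem realEuler_ball : ∀ d : ℕ, realEuler d (ball d) = (-1) ^ d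
  | 0 => by
    have h := realEuler_box (m := 0) Fin.elim0 Fin.elim0 (fun i => i.elim0)
    have hset : {v : Fin 0 → ℝ | ∀ i, Fin.elim0 i < v i ∧ v i < Fin.elim0 i} = ball 0 := by
      ext v
      simp [ball]
    rwa [hset] at h
  | d + 1 => by
    have hS : (univ : Set ℝ).Definable Language.orderedRing (ball (d + 1)) :=
      definable_univ_of_isSemialgebraic (isSemialgebraic_ball _)
    have hmem : ∀ (a : Fin d → ℝ) (y : Fin 1 → ℝ),
        Fin.append a y ∈ ball (d + 1) ↔ (∑ i, a i ^ 2) + y 0 ^ 2 < 1 := by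
      intro a y
      simp only [ball, mem_setOf_eq, Fin.sum_univ_add, Fin.append_left, Fin.append_right,
        Fin.sum_univ_one]
    have hproj : {a : Fin d → ℝ | ∃ y : Fin 1 → ℝ, Fin.append a y ∈ ball (d + 1)} = ball d := by
      ext a
      simp only [mem_setOf_eq, hmem]
      constructor
      · rintro ⟨y, hy⟩
        have := sq_nonneg (y 0)
        show ∑ i, a i ^ 2 < 1
        linarith
      · intro ha
        refine ⟨fun _ => 0, ?_⟩
        have ha' : ∑ i, a i ^ 2 < 1 := ha
        simpa using ha'
    rw [realEuler, eulerChar_eq_eulerChar_proj_mul isOMinimal_real definable_lt_real hS (e := -1)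
      fun a ⟨y, hy⟩ => ?_, hproj]
    · have h := realEuler_ball d
      rw [realEuler] at h
      rw [h, pow_succ]
    · have hs : ∑ i, a i ^ 2 < 1 := by
        have h := (hmem a y).1 hy
        have := sq_nonneg (y 0)
        linarith
      set c := 1 - ∑ i, a i ^ 2 with hc
      have hcpos : 0 < c := by rw [hc]; linarith
      have hset : {y : Fin 1 → ℝ | Fin.append a y ∈ ball (d + 1)} =
          {y | -Real.sqrt c < y 0 ∧ y 0 < Real.sqrt c} := by
        ext y
        rw [mem_setOf_eq, hmem, mem_setOf_eq, ← Real.sq_lt, hc]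
        constructor <;> intro h <;> linarith
      rw [hset]
      have hlt : -Real.sqrt c < Real.sqrt c := by
        have := Real.sqrt_pos.mpr hcpos
        linarith
      exact realEuler_Ioo hlt

/-- `E` of the open unit cube `(0,1)^N` is `(−1)^N`. [cite: Dries1998, Ch. 4 (2.1)] -/
theorem realEuler_cube (N : ℕ) : realEuler N {t : Fin N → ℝ | ∀ j, t j ∈ Set.Ioo (0:ℝ) 1} = (-1) ^ N :=
  realEuler_box (fun _ => 0) (fun _ => 1) (fun _ => zero_lt_one)

/-- **`E(B^{2k} × (0,1)^{N'}) = (−1)^{2k} · (−1)^{N'}`** (product formula, tree `eulerChar_prod`).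
[cite: Dries1998, Ch. 4 (2.11)] -/
theorem realEuler_ballCube (k N' : ℕ) :
    realEuler (2 * k + N') {z : Fin (2 * k + N') → ℝ | (∑ i : Fin (2 * k), (z (Fin.castAdd N' i)) ^ 2) < 1 ∧
      ∀ l : Fin N', z (Fin.natAdd (2 * k) l) ∈ Set.Ioo (0:ℝ) 1} = (-1) ^ (2 * k) * (-1) ^ N' := by
  have hA : (univ : Set ℝ).Definable Language.orderedRing (ball (2 * k)) :=
    definable_univ_of_isSemialgebraic (isSemialgebraic_ball _)
  have hB : (univ : Set ℝ).Definable Language.orderedRing {t : Fin N' → ℝ | ∀ j, t j ∈ Set.Ioo (0:ℝ) 1} :=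
    definable_box (fun _ => 0) (fun _ => 1) (fun _ => zero_lt_one)
  have h := eulerChar_prod isOMinimal_real definable_lt_real hA hB
  have hb := realEuler_ball (2 * k)
  have hc := realEuler_cube N'
  rw [realEuler] at hb hc
  rw [hb, hc] at h
  rw [realEuler, ← h]
  rfl

/-- The Euler characteristics of both Γ-pair domains are ODD. [folklore] -/
theorem odd_realEuler_cube (N : ℕ) : Odd (realEuler N {t : Fin N → ℝ | ∀ j, t j ∈ Set.Ioo (0:ℝ) 1}) := by
  rw [realEuler_cube]
  exact odd_neg_one.pow

/-- `E(B^{2k} × (0,1)^{N'})` is odd. [folklore] -/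
theorem odd_realEuler_ballCube (k N' : ℕ) :
    Odd (realEuler (2 * k + N') {z : Fin (2 * k + N') → ℝ | (∑ i : Fin (2 * k), (z (Fin.castAdd N' i)) ^ 2) < 1 ∧
      ∀ l : Fin N', z (Fin.natAdd (2 * k) l) ∈ Set.Ioo (0:ℝ) 1}) := by
  rw [realEuler_ballCube]
  exact odd_neg_one.pow.mul odd_neg_one.pow

end Summit.KontsevichZagierPeriods.CompleteModGammaSectorNegative
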